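import Summits.ResolutionOfSingularities.ResolutionOfSingularities.Theorems.FrobeniusClosingPatchingRelPerfectAtomDimLeThree
import Summits.ResolutionOfSingularities.ResolutionOfSingularities.Theorems.ValuativePatchingRelDimThreeFormat
import Summits.ResolutionOfSingularities.ResolutionOfSingularities.Theorems.PAlterationPicoverLocalBlowups
import Literature.AlgebraicGeometry.Resolution.Temkin2008Localization
import Literature.AlgebraicGeometry.Resolution.ExcellentRingsEssFiniteType
import Literature.AlgebraicGeometry.Resolution.ExcellentRingsFieldProofs
import Literature.AlgebraicGeometry.Resolution.BlowupDimension
import Literature.AlgebraicGeometry.Resolution.BlowupsIntegral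
import Literature.AlgebraicGeometry.Resolution.BlowupsProperProofs
import Literature.AlgebraicGeometry.Motives.AbelianVarietyIsogenyProofs
import Mathlib.RingTheory.EssentialFiniteness
import HarnessLib

/-!
# Crux `PatchingPerfect` (stmt-ResolutionOfSingularities-16089), line `birth` (skeleton v5):
# stub `stub_nonClosedAtomDimLeThree` (E5) — the Sing-format atom over regular local bases
# essentially of finite type over a field, dimension `≤ 3`

Routes `ResolutionOfSingularities/IndSmooth` and `ResolutionOfSingularities/AbhyankarShadows`,
crux `PatchingPerfect` (Zariski's patching over ONE perfect field). Skeleton v5 of the line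
`birth` atomizes the crux in all dimensions; at NON-closed roof points the engine needs punctual
atoms in SING-FORMAT (centre inside the singular locus). This file proves the registered stub
`stub_nonClosedAtomDimLeThree`, verbatim: the atom below the Cossart–Piltant frontier — regular
local bases `S` ESSENTIALLY OF FINITE TYPE over an arbitrary field `k`, `dim S ≤ 3` — which is
TRUE modulo the printed inputs carried as hypotheses: Cossart–Piltant 2019, Thm. 1.1
(`CossartPiltant2019General`) and Prop. 4.4 (`CossartPiltant2019Principalization`), and
Cossart–Jannsen–Saito 2020, Thm. 1.2 in Temkin's desingularization format (`hCJS`).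

## Proof (the pattern of `Theorems.stub_atomDimLeThree`, with the eft base in place of the
## complete one, stopped one step earlier: the centre is kept inside `Sing T`)

Let `f : T → Spec S` be proper and birational, `T` integral.

* `S` is excellent: a field is excellent (`isExcellentRing_of_field`) and excellence passes to
  essentially finite type algebras (`IsExcellentRing.of_essFiniteType`, Matsumura §32 p. 260).
* `T` is Noetherian and separated (proper over the Noetherian affine base) and EXCELLENT, being
  locally of finite type over the excellent ring `S`
  (`Picover.LocalBlowups.isExcellent_of_locallyOfFiniteType_of_isExcellentRing`).
* `dim T ≤ dim S ≤ 3` (`topologicalKrullDim_le_of_isProper_of_isBirational`, Raynaud–Gruson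
  domination + blowing up does not raise dimension).
* If `dim T ≤ 2`: `hCJS` gives a blowing up `π : T' → T` along `J` with `V(J) ⊆ Sing T` and `T'`
  regular; `J ≠ 0` because the generic point of `T` is regular (`genericPoint_mem_regularLocus`).
* If `dim T = 3`: Cossart–Piltant Thm. 1.1 gives a strong resolution `φ : Y → T`, an
  isomorphism over the open `W = Reg T ∋ ξ_T`; `Y` is integral, Noetherian, excellent (of finite
  type over `S` through `φ ≫ f`) and of dimension EXACTLY `3` (`≤ 3` as a proper birational
  `S`-scheme, `≥ dim T = 3` because `φ` is proper and surjective). So Prop. 4.4 in blow-up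
  format (`formatPrincipalization_dim3_of_cossartPiltant`) is Axiom 4 on `Y`, and the format
  upgrade `exists_isBlowup_supported_isRegular_of_isIso_over` yields ONE non-zero blowing up of
  `T` cosupported in `T ∖ W = Sing T`, with regular source.

The hypothesis `hoff` (regularity off the closed fibre) is not needed below the frontier: the
printed theorems resolve every excellent reduced separated Noetherian scheme of dimension `≤ 3`.
It is kept for the registered signature.

## Sources

* V. Cossart, O. Piltant, *Resolution of singularities of arithmetical threefolds*, J. Algebra
  529 (2019) 268–535, Thm. 1.1 and Prop. 4.4. [CossartPiltant2019]
* V. Cossart, U. Jannsen, S. Saito, *Desingularization: invariants and strategy — application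
  to dimension 2*, Lecture Notes in Math. 2270 (2020), Thm. 1.2. [CossartJannsenSaito2020]
* M. Temkin, *Desingularization of quasi-excellent schemes in characteristic zero*, Adv. Math.
  219 (2008) 488–522, Def. 2.2.6, Lemma 2.1.4. [Temkin2008]
* H. Matsumura, *Commutative Ring Theory*, CUP 1986, Thm. 15.5, §32 p. 260. [Matsumura1987]
* The Stacks Project, Tags 081T, 07QU. [StacksProject]
-/

set_option linter.dupNamespace false -- single-problem summit: doubled namespace component is forced

noncomputable section

open CategoryTheory CategoryTheory.Limits AlgebraicGeometry Literature.AlgebraicGeometry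
open Literature.AlgebraicGeometry.Resolution

namespace Summit.ResolutionOfSingularities.ResolutionOfSingularities.Theorems

/-- **The non-closed atom below the frontier: eft regular local bases of dimension `≤ 3`**
(TRUE modulo the printed inputs). Let `S` be a regular local ring essentially of finite type
over a field `k`, of dimension `≤ 3`, and `T` integral, proper and birational over `Spec S`.
Then `T` is Noetherian, separated, excellent (of finite type over the excellent ring `S`:
`isExcellentRing_of_field` + `IsExcellentRing.of_essFiniteType`) of dimension `≤ 3`
(`topologicalKrullDim_le_of_isProper_of_isBirational`). If `dim T ≤ 2`, the printed
Cossart–Jannsen–Saito theorem `hCJS` gives a `Sing T`-supported blowing up with regular source;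
if `dim T = 3`, Cossart–Piltant Thm. 1.1 (`hG`) gives a strong resolution `φ : Y → T`, an
isomorphism over `Reg T`, with `Y` integral, excellent, of dimension exactly `3`, so Prop. 4.4 in
blow-up format (`formatPrincipalization_dim3_of_cossartPiltant hP`) is Axiom 4 on `Y` and the
format upgrade `exists_isBlowup_supported_isRegular_of_isIso_over` yields ONE `Sing T`-supported
blowing up with regular source. In both cases the centre misses the (regular) generic point, so
it is non-zero. The off-fibre regularity `hoff` is not used.
[cite: CossartPiltant2019, Thm. 1.1 and Prop. 4.4] [cite: CossartJannsenSaito2020, Thm. 1.2] -/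
theorem stub_nonClosedAtomDimLeThree
    (hG : CossartPiltant2019General.{0}) (hP : CossartPiltant2019Principalization.{0})
    (hCJS : ∀ (X : Scheme.{0}) [IsNoetherian X] [IsReduced X], Scheme.IsExcellent X →
      topologicalKrullDim X ≤ 2 → Scheme.AdmitsDesingularization X)
    (k : Type) [Field k] (S : Type) [CommRing S] [IsRegularLocalRing S] [Algebra k S]
    [Algebra.EssFiniteType k S] (hdim : ringKrullDim S ≤ (3 : ℕ))
    (T : Scheme.{0}) (f : T ⟶ Spec (.of S)) [IsIntegral T] [IsProper f] (hbir : IsBirational f)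
    (hoff : ∀ t : T, f.base t ≠ IsLocalRing.closedPoint S → IsRegularLocalRing (T.presheaf.stalk t)) :
    ∃ (J : T.IdealSheafData) (T' : Scheme.{0}) (π : T' ⟶ T), J ≠ ⊥ ∧
      (∀ t : T, t ∈ J.support → ¬ IsRegularLocalRing (T.presheaf.stalk t)) ∧
      IsBlowup π J ∧ Scheme.IsRegular T' := by
  have _ := hoff
  -- the base: an integral Noetherian excellent affine scheme of dimension `≤ 3`
  haveI : IsDomain S := isDomain_of_isRegularLocalRing S
  haveI : IsDomain (CommRingCat.of S) := ‹IsDomain S›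
  haveI : IsNoetherianRing (CommRingCat.of S) := (inferInstance : IsNoetherianRing S)
  have hexcS : IsExcellentRing S :=
    (isExcellentRing_of_field k).of_essFiniteType ‹Algebra.EssFiniteType k S›
  have hdimS : topologicalKrullDim (Spec (.of S)) ≤ (3 : ℕ) := by
    change topologicalKrullDim (PrimeSpectrum S) ≤ _
    rw [PrimeSpectrum.topologicalKrullDim_eq_ringKrullDim]
    exact hdim
  -- `T` is Noetherian, separated, excellent, of dimension `≤ 3`
  haveI : IsLocallyNoetherian T := LocallyOfFiniteType.isLocallyNoetherian f
  haveI : CompactSpace T := QuasiCompact.compactSpace_of_compactSpace f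
  haveI : IsNoetherian T := {}
  haveI : T.IsSeparated := Scheme.isSeparated_of_isSeparated_over f
  have hexc : Scheme.IsExcellent T :=
    Picover.LocalBlowups.isExcellent_of_locallyOfFiniteType_of_isExcellentRing hexcS f
  have hdimT : topologicalKrullDim T ≤ (3 : ℕ) :=
    topologicalKrullDim_le_of_isProper_of_isBirational f hbir hdimS
  by_cases h2 : topologicalKrullDim T ≤ 2
  · -- dimension `≤ 2`: Cossart–Jannsen–Saito
    obtain ⟨T', π, hπ⟩ := hCJS T hexc h2
    obtain ⟨J, hJ, hsupp⟩ := hπ.exists_isBlowup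
    refine ⟨J, T', π, ?_, fun t ht hreg => hsupp ht hreg, hJ, hπ.isRegular⟩
    rintro rfl
    have : genericPoint T ∈ ((⊥ : T.IdealSheafData).support : Set T) := by
      rw [Scheme.IdealSheafData.support_bot]; trivial
    exact hsupp this (genericPoint_mem_regularLocus T)
  · -- dimension `3`: Cossart–Piltant Thm. 1.1 + Prop. 4.4 through the format upgrade
    have hdimT3 : topologicalKrullDim T = 3 :=
      le_antisymm (by exact_mod_cast hdimT) (Picover.LocalBlowups.three_le_of_not_le_two h2)
    obtain ⟨Y, φ, hres, W, hW, hiso⟩ := hG T hexc.isQuasiExcellent hdimT3.le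
    haveI := hres.isProper
    haveI := hiso
    haveI : IsIntegral Y := by
      haveI := hres.isRegular.isReduced
      exact hres.isBirational.isIntegral
    have hgenW : genericPoint T ∈ W := by
      show genericPoint T ∈ (W : Set T)
      rw [hW]
      exact genericPoint_mem_regularLocus T
    -- `Y` is Noetherian and excellent (of finite type over `S` via `φ ≫ f`) of dimension `3`
    haveI : IsLocallyNoetherian Y := LocallyOfFiniteType.isLocallyNoetherian φ
    haveI : CompactSpace Y := QuasiCompact.compactSpace_of_compactSpace φ
    haveI : IsNoetherian Y := {}
    have hexcY : Scheme.IsExcellent Y :=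
      Picover.LocalBlowups.isExcellent_of_locallyOfFiniteType_of_isExcellentRing hexcS (φ ≫ f)
    have hdimY : topologicalKrullDim Y = 3 := by
      apply le_antisymm
      · exact_mod_cast topologicalKrullDim_le_of_isProper_of_isBirational (φ ≫ f)
          (hres.isBirational.comp hbir) hdimS
      · haveI : Surjective φ := ⟨hres.isBirational.surjective_of_universallyClosed⟩
        rw [← hdimT3]
        exact Motives.Scheme.topologicalKrullDim_le_of_universallyClosed_of_surjective φ
    -- Axiom 4 on `Y`: Cossart–Piltant Prop. 4.4 in blow-up format
    have hA4 : ∀ I' : Y.IdealSheafData, I' ≠ ⊥ →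
        ∃ (Q : Y.IdealSheafData) (Y₁ : Scheme.{0}) (σ : Y₁ ⟶ Y),
          (Q.support : Set Y) ⊆ I'.support ∧ IsBlowup σ Q ∧ Scheme.IsRegular Y₁ ∧
            IsEffectiveCartier (I'.comap σ) := fun I' hI' =>
      formatPrincipalization_dim3_of_cossartPiltant hP Y hres.isRegular hexcY hdimY I' hI'
    -- the format upgrade
    obtain ⟨Q', V'', ρ, hQ', hQ'T, hρ, hreg''⟩ :=
      exists_isBlowup_supported_isRegular_of_isIso_over φ W hgenW hA4
    refine ⟨Q', V'', ρ, hQ', fun t ht hreg => hQ'T ht ?_, hρ, hreg''⟩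
    show t ∈ (W : Set T)
    rw [hW]
    exact hreg

end Summit.ResolutionOfSingularities.ResolutionOfSingularities.Theorems

end
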